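import Summits.QuantumFields.YangMills.Theorems.ParabolicTrajectoryContinuumLimitOnTrajectoryUclObs
import Literature.MathematicalPhysics.QuantumLattice.MeshUniformLatticeSums
import Literature.MathematicalPhysics.QuantumLattice.SchwingerOSAxioms

/-!
# Crux `ContinuumLimitOnTrajectory` (stmt-QuantumFields-10522), line `two-orbit-synchronisation` (seat c2):
# lattice Riemann sums of test functions and the sup norm of lattice observables

Helper file (`--supports stmt-QuantumFields-10522`) for the registered stub `stub_uclOfGap : UCLOfGap` (skeleton v3.1).
The crude (UV-divergent but Schwartz-controlled) size of the lattice observable of a `p`-point test function: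

* `sum_norm_apply_smul_siteToE_le` — `∑_{x ∈ (box 4 S)^p} ‖F(a x⃗)‖ ≤ a^{-4p} (2(a+1))^{4p} 2^{8p} ‖F‖_{8p}`
  (tree `sum_piFinset_box_japaneseBracket_le` and Mathlib `one_add_le_sup_seminorm_apply`; `‖F‖_{8p}` the tree's `schwartzNorm`);
* `norm_obsOf_le_schwartzNorm` — hence `‖obsOf r sch k p F U‖ ≤ |C|^p a_k^{-4p} (2(a_k+1))^{4p} 2^{8p} ‖F‖_{8p}`.

Against the Schwartz decay of a far tail (`‖F_far‖_{8p} ≲ R^{-N} ‖F‖_{8p+N}`, half-space cutoffs) this is how the clustering leg disposes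
of the pieces of a test function beyond the `k`-dependent window radius. Vocabulary: `…UclObs`. Refs: Glimm–Jaffe 1987 §9.5.
-/

set_option autoImplicit false

open scoped SchwartzMap
open MeasureTheory Filter Topology Finset
open Literature.MathematicalPhysics.QuantumFieldTheory Literature.MathematicalPhysics.QuantumLattice
open Literature.MathematicalPhysics.AQFT Literature.Probability.LatticeModels

noncomputable section

namespace Summit.QuantumFields.YangMills.Cruxes.ContinuumLimitOnTrajectory.TwoOrbitSynchronisation

local notation "𝔼" => EuclideanSpace ℝ (Fin 4)

/-- **Pointwise Schwartz decay in the tree's currency**: `‖F y‖ ≤ 2^M ‖F‖_M (1 + ‖y‖)^{-M}`. -/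
theorem norm_apply_le_schwartzNorm_mul {p : ℕ} (M : ℕ) (F : 𝓢((Fin p → 𝔼), ℂ)) (y : Fin p → 𝔼) :
    ‖F y‖ ≤ 2 ^ M * schwartzNorm M F * ((1 + ‖y‖) ^ M)⁻¹ := by
  have h := SchwartzMap.one_add_le_sup_seminorm_apply (𝕜 := ℂ) (m := (M, M)) (k := M) (n := 0) le_rfl (Nat.zero_le _) F y
  rw [norm_iteratedFDeriv_zero] at h
  have hpos : 0 < (1 + ‖y‖) ^ M := by positivity
  rw [le_mul_inv_iff₀ hpos]
  calc ‖F y‖ * (1 + ‖y‖) ^ M = (1 + ‖y‖) ^ M * ‖F y‖ := mul_comm _ _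
    _ ≤ 2 ^ M * (Finset.Iic (M, M)).sup (fun m => SchwartzMap.seminorm ℂ m.1 m.2) F := h
    _ = 2 ^ M * schwartzNorm M F := rfl

/-- **Lattice Riemann sum of a test function over the box.** For `0 < a`:
`∑_{x : Fin p → box 4 S} ‖F(a x⃗)‖ ≤ a^{-4p} (2(a+1))^{4p} 2^{8p} ‖F‖_{8p}`. -/
theorem sum_norm_apply_smul_siteToE_le {p : ℕ} {a : ℝ} (ha : 0 < a) (S : ℕ) (F : 𝓢((Fin p → 𝔼), ℂ)) :
    ∑ x : Fin p → ↥(box 4 S), ‖F (fun i => a • siteToE (↑(x i) : Site 4))‖ ≤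
      (a ^ (4 * p))⁻¹ * (2 * (a + 1)) ^ (4 * p) * (2 ^ (8 * p) * schwartzNorm (8 * p) F) := by
  set K : ℝ := 2 ^ (8 * p) * schwartzNorm (8 * p) F with hK
  have hK0 : 0 ≤ K := by rw [hK]; exact mul_nonneg (by positivity) (schwartzNorm_nonneg _ _)
  -- pass from subtype-valued tuples to the product finset
  have hsum : ∑ x : Fin p → ↥(box 4 S), ‖F (fun i => a • siteToE (↑(x i) : Site 4))‖ =
      ∑ x ∈ Fintype.piFinset (fun _ : Fin p => box 4 S), ‖F (fun i => a • siteToE (x i))‖ := by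
    rw [← Finset.sum_coe_sort (Fintype.piFinset fun _ : Fin p => box 4 S)]
    refine Fintype.sum_equiv ((Equiv.subtypePiEquivPi (p := fun _ : Fin p => fun y : Site 4 => y ∈ box 4 S)).symm.trans
      (Equiv.subtypeEquivRight fun f => by simp [Fintype.mem_piFinset])) _ _ fun x => rfl
  rw [hsum]
  have hpt : ∀ x : Fin p → Site 4, ‖F (fun i => a • siteToE (x i))‖ ≤
      K * ((1 + ‖fun i => a • siteToE (x i)‖) ^ (8 * p))⁻¹ := fun x => by
    have := norm_apply_le_schwartzNorm_mul (8 * p) F (fun i => a • siteToE (x i))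
    rwa [hK]
  have hjb := sum_piFinset_box_japaneseBracket_le a ha.le 4 p S
  have hap : 0 < a ^ (4 * p) := pow_pos ha _
  calc ∑ x ∈ Fintype.piFinset (fun _ : Fin p => box 4 S), ‖F (fun i => a • siteToE (x i))‖
      ≤ ∑ x ∈ Fintype.piFinset (fun _ : Fin p => box 4 S), K * ((1 + ‖fun i => a • siteToE (x i)‖) ^ (8 * p))⁻¹ :=
        Finset.sum_le_sum fun x _ => hpt x
    _ = (a ^ (4 * p))⁻¹ * K * ∑ x ∈ Fintype.piFinset (fun _ : Fin p => box 4 S),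
          a ^ (4 * p) / (1 + ‖fun i => a • siteToE (x i)‖) ^ (2 * (4 * p)) := by
        rw [Finset.mul_sum]
        refine Finset.sum_congr rfl fun x _ => ?_
        have : 2 * (4 * p) = 8 * p := by ring
        rw [this, div_eq_mul_inv]
        field_simp
    _ ≤ (a ^ (4 * p))⁻¹ * K * (2 * (a + 1)) ^ (4 * p) :=
        mul_le_mul_of_nonneg_left hjb (mul_nonneg (inv_nonneg.2 hap.le) hK0)
    _ = (a ^ (4 * p))⁻¹ * (2 * (a + 1)) ^ (4 * p) * K := by ring

/-- **Sup norm of the lattice observable of a test function**: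
`‖obsOf r sch k p F U‖ ≤ |C|^p · a_k^{-4p} (2(a_k+1))^{4p} 2^{8p} ‖F‖_{8p}`, `C` any bound on the curvature weights. -/
theorem norm_obsOf_le_schwartzNorm :
    ∀ {G : Type} [Group G] [TopologicalSpace G] [IsTopologicalGroup G] [CompactSpace G] [MeasurableSpace G] [BorelSpace G]
      (r : LatticeRep G) (sch : SpeciesScheme (YMSpecies G)) (k p : ℕ) {C : ℝ}, (∀ x U, |cw r sch k x U| ≤ C) →
      ∀ (F : 𝓢((Fin p → EuclideanSpace ℝ (Fin 4)), ℂ)) (U : GaugeConfig 4 (sch.side k) G),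
        ‖obsOf r sch k p F U‖ ≤
          |C| ^ p * ((sch.a k ^ (4 * p))⁻¹ * (2 * (sch.a k + 1)) ^ (4 * p) * (2 ^ (8 * p) * schwartzNorm (8 * p) F)) := by
  intro G _ _ _ _ _ _ r sch k p C hC F U
  calc ‖obsOf r sch k p F U‖
      ≤ (∑ x : Fin p → ↥(box 4 (sch.L k)), ‖F (fun i => sch.a k • siteToE (↑(x i) : Site 4))‖) * |C| ^ p :=
        norm_obsOf_le r sch k p hC F U
    _ ≤ ((sch.a k ^ (4 * p))⁻¹ * (2 * (sch.a k + 1)) ^ (4 * p) * (2 ^ (8 * p) * schwartzNorm (8 * p) F)) * |C| ^ p :=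
        mul_le_mul_of_nonneg_right (sum_norm_apply_smul_siteToE_le (sch.a_pos k) _ F) (by positivity)
    _ = _ := mul_comm _ _

end Summit.QuantumFields.YangMills.Cruxes.ContinuumLimitOnTrajectory.TwoOrbitSynchronisation

end
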